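import Mathlib
import HarnessLib
import Literature.MathematicalPhysics.KineticTheory.HardSphereEuler
import Literature.MathematicalPhysics.KineticTheory.BackwardCluster
import Summits.AtomisticToContinuum.HydrodynamicLimit.Theses.RelayRaceLocality
import Summits.AtomisticToContinuum.HydrodynamicLimit.Theorems.RelayRaceLocalityGibbsLightConeStubWindowComposition
import Summits.AtomisticToContinuum.HydrodynamicLimit.Theorems.RelayRaceLocalityGibbsLightConeStubClusterShift
import Summits.AtomisticToContinuum.HydrodynamicLimit.Theorems.RelayRaceLocalityGibbsLightConeStubGibbsInvariance
import Summits.AtomisticToContinuum.HydrodynamicLimit.Theorems.RelayRaceLocalityGibbsLightConeStubAsymptotics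
import Summits.AtomisticToContinuum.HydrodynamicLimit.Theorems.RelayRaceLocalityGibbsLightConeStubReduction
import Summits.AtomisticToContinuum.HydrodynamicLimit.Theorems.RelayRaceLocalityGibbsLightConeStubAsymptoticsLog
import Summits.AtomisticToContinuum.HydrodynamicLimit.Theorems.RelayRaceLocalityGibbsLightConeStubReductionLog

/-!
# Bridges `C⁺ → GibbsLightCone` of the line `Sketch` (log-window-tagged-tail) for the crux
`RelayRaceLocality.GibbsLightCone` (stmt-AtomisticToContinuum-12501)

Support file (`--supports stmt-AtomisticToContinuum-12501`) of the line's lead prover. With the five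
structural stubs of the registered skeleton `Cruxes/GibbsLightCone/Lines/Sketch.lean` landed
(`stub_windowComposition`, `stub_clusterShift`, `stub_gibbsInvariance`, `stub_asymptoticsLog`,
`stub_reductionLog`, and the strong-form pair `stub_asymptotics`, `stub_reduction`), the crux is ONE
hypothesis away from a single kinetic-scale statement about ONE tagged sphere. This file records the
single-hypothesis bridges in the tree:

* `gibbsLightCone_of_taggedLogWindowSpanTail` : C⁺_log → GibbsLightCone — the tagged LOG-window span
  tail (exponential-in-`M` tail of the span of the backward cluster of one tagged particle over
  `1 ≤ M ≤ K log(N+2)` mean-free-time units, every `K`, eventually in `N`) implies the crux;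
* `gibbsLightCone_of_taggedWindowSpanTail` : C⁺_strong → GibbsLightCone — the same tail asked
  uniformly in all `M ≥ 1` implies the crux (and trivially implies C⁺_log);
* (companion file `RelayRaceLocalityGibbsLightConeChainBridge.lean`) the chain form
  `gibbsLightCone_of_chainPathLengthTail` : ChainTail → GibbsLightCone via the landed chain stubs.

`nullOffGood` (the Gibbs law does not charge the complement of the good set) is the one hypothesis of
the reductions proved here. The hypotheses C⁺_log / C⁺_strong are written out verbatim (they are the
registered stub `stub_taggedLogWindowSpanTail` of the skeleton, resp. the former
`stub_taggedWindowSpanTail`); nothing is asserted about them.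
-/

namespace Summit.AtomisticToContinuum.HydrodynamicLimit.Theorems.LogWindowTaggedTail

open Literature.MathematicalPhysics.KineticTheory Literature.Analysis.FluidPDE MeasureTheory Filter Set

open scoped ENNReal

/-- The homogeneous Gibbs law does not charge the complement of the good set of the flow (it is
absolutely continuous with respect to the Liouville measure, `particleLaw = liouville.withDensity _`,
and `liouville goodᶜ = 0`). [folklore] -/
theorem nullOffGood :
    ∀ (σ a θ : ℝ) (N : ℕ)
      (Φ : HardSphereFlow (Torus.geometry (Fin 3)) (hsDiameter σ N) (N + 1)),
      localGibbsLaw σ (fun _ => a) (fun _ => 0) (fun _ => θ) N Φ Φ.goodᶜ = 0 := by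
  intro σ a θ N Φ
  rw [localGibbsLaw, particleLaw_eq]
  exact withDensity_absolutelyContinuous _ _ Φ.measure_compl_good

/-- BRIDGE (log form): the tagged LOG-window span tail C⁺_log — for the equilibrium hard-sphere gas
at fixed small reduced density there are `λ, c > 0, C` such that for every `K > 0`, eventually in
`N`, the backward cluster of one tagged particle `p` over a window of `M` mean-free-time units
`τ_N = ℓ_N/√θ`, `ℓ_N = (N+1)^{-1/3}/σ²`, `1 ≤ M ≤ K log(N+2)`, together with `p` itself, started
within `λ M ℓ_N` of `x_p(M τ_N)` except on an event of Gibbs probability `≤ C e^{-cM}` — implies the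
crux `RelayRaceLocality.GibbsLightCone` (log-window union bound: `stub_reductionLog` fed with the
landed stubs). [folklore] -/
theorem gibbsLightCone_of_taggedLogWindowSpanTail :
    (∀ a θ : ℝ, 0 < a → 0 < θ → ∃ σ₀ : ℝ, 0 < σ₀ ∧ ∃ lam c C : ℝ, 0 < c ∧ ∀ K : ℝ, 0 < K →
      ∀ σ : ℝ, 0 < σ → σ < σ₀ →
      ∀ Φ : (N : ℕ) → HardSphereFlow (Torus.geometry (Fin 3)) (hsDiameter σ N) (N + 1),
      ∀ᶠ N in atTop, ∀ p : Fin (N + 1), ∀ M : ℝ, 1 ≤ M → M ≤ K * Real.log ((N : ℝ) + 2) →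
        localGibbsLaw σ (fun _ => a) (fun _ => 0) (fun _ => θ) N (Φ N)
          {z | ∃ r : Fin (N + 1),
              (r = p ∨ r ∈ (Φ N).backwardCluster p 0
                (M * (((N + 1 : ℕ) : ℝ) ^ (-(1 / 3 : ℝ)) / σ ^ 2 / Real.sqrt θ)) z) ∧
              lam * M * (((N + 1 : ℕ) : ℝ) ^ (-(1 / 3 : ℝ)) / σ ^ 2) <
                Torus.euclidDist (z r).1
                  (((Φ N).flow (M * (((N + 1 : ℕ) : ℝ) ^ (-(1 / 3 : ℝ)) / σ ^ 2 / Real.sqrt θ)) z)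
                    p).1}
          ≤ ENNReal.ofReal (C * Real.exp (-c * M))) →
    Summit.AtomisticToContinuum.HydrodynamicLimit.Theses.RelayRaceLocality.GibbsLightCone :=
  fun hTail => stub_reductionLog stub_windowComposition stub_clusterShift stub_gibbsInvariance nullOffGood
    stub_asymptoticsLog hTail

/-- BRIDGE (strong form): the tagged window span tail C⁺_strong — the same exponential-in-`M` tail
asked uniformly in ALL `M ≥ 1` (eventually in `N`, uniformly in the particle) — implies the crux
`RelayRaceLocality.GibbsLightCone` (`stub_reduction` fed with the landed stubs; this form is
consumed at the single macroscopic window `M = t/τ_N` by the landed `stub_asymptotics`). [folklore] -/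
theorem gibbsLightCone_of_taggedWindowSpanTail :
    (∀ a θ : ℝ, 0 < a → 0 < θ → ∃ σ₀ : ℝ, 0 < σ₀ ∧ ∃ lam c C : ℝ, 0 < c ∧
      ∀ σ : ℝ, 0 < σ → σ < σ₀ →
      ∀ Φ : (N : ℕ) → HardSphereFlow (Torus.geometry (Fin 3)) (hsDiameter σ N) (N + 1),
      ∀ᶠ N in atTop, ∀ p : Fin (N + 1), ∀ M : ℝ, 1 ≤ M →
        localGibbsLaw σ (fun _ => a) (fun _ => 0) (fun _ => θ) N (Φ N)
          {z | ∃ r : Fin (N + 1),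
              (r = p ∨ r ∈ (Φ N).backwardCluster p 0
                (M * (((N + 1 : ℕ) : ℝ) ^ (-(1 / 3 : ℝ)) / σ ^ 2 / Real.sqrt θ)) z) ∧
              lam * M * (((N + 1 : ℕ) : ℝ) ^ (-(1 / 3 : ℝ)) / σ ^ 2) <
                Torus.euclidDist (z r).1
                  (((Φ N).flow (M * (((N + 1 : ℕ) : ℝ) ^ (-(1 / 3 : ℝ)) / σ ^ 2 / Real.sqrt θ)) z)
                    p).1}
          ≤ ENNReal.ofReal (C * Real.exp (-c * M))) →
    Summit.AtomisticToContinuum.HydrodynamicLimit.Theses.RelayRaceLocality.GibbsLightCone :=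
  fun hTail => stub_reduction stub_windowComposition stub_clusterShift stub_gibbsInvariance nullOffGood
    stub_asymptotics hTail

/-- C⁺_strong trivially implies C⁺_log (drop the upper constraint on the window). [folklore] -/
theorem taggedLogWindowSpanTail_of_taggedWindowSpanTail :
    (∀ a θ : ℝ, 0 < a → 0 < θ → ∃ σ₀ : ℝ, 0 < σ₀ ∧ ∃ lam c C : ℝ, 0 < c ∧
      ∀ σ : ℝ, 0 < σ → σ < σ₀ →
      ∀ Φ : (N : ℕ) → HardSphereFlow (Torus.geometry (Fin 3)) (hsDiameter σ N) (N + 1),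
      ∀ᶠ N in atTop, ∀ p : Fin (N + 1), ∀ M : ℝ, 1 ≤ M →
        localGibbsLaw σ (fun _ => a) (fun _ => 0) (fun _ => θ) N (Φ N)
          {z | ∃ r : Fin (N + 1),
              (r = p ∨ r ∈ (Φ N).backwardCluster p 0
                (M * (((N + 1 : ℕ) : ℝ) ^ (-(1 / 3 : ℝ)) / σ ^ 2 / Real.sqrt θ)) z) ∧
              lam * M * (((N + 1 : ℕ) : ℝ) ^ (-(1 / 3 : ℝ)) / σ ^ 2) <
                Torus.euclidDist (z r).1
                  (((Φ N).flow (M * (((N + 1 : ℕ) : ℝ) ^ (-(1 / 3 : ℝ)) / σ ^ 2 / Real.sqrt θ)) z)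
                    p).1}
          ≤ ENNReal.ofReal (C * Real.exp (-c * M))) →
    ∀ a θ : ℝ, 0 < a → 0 < θ → ∃ σ₀ : ℝ, 0 < σ₀ ∧ ∃ lam c C : ℝ, 0 < c ∧ ∀ K : ℝ, 0 < K →
      ∀ σ : ℝ, 0 < σ → σ < σ₀ →
      ∀ Φ : (N : ℕ) → HardSphereFlow (Torus.geometry (Fin 3)) (hsDiameter σ N) (N + 1),
      ∀ᶠ N in atTop, ∀ p : Fin (N + 1), ∀ M : ℝ, 1 ≤ M → M ≤ K * Real.log ((N : ℝ) + 2) →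
        localGibbsLaw σ (fun _ => a) (fun _ => 0) (fun _ => θ) N (Φ N)
          {z | ∃ r : Fin (N + 1),
              (r = p ∨ r ∈ (Φ N).backwardCluster p 0
                (M * (((N + 1 : ℕ) : ℝ) ^ (-(1 / 3 : ℝ)) / σ ^ 2 / Real.sqrt θ)) z) ∧
              lam * M * (((N + 1 : ℕ) : ℝ) ^ (-(1 / 3 : ℝ)) / σ ^ 2) <
                Torus.euclidDist (z r).1
                  (((Φ N).flow (M * (((N + 1 : ℕ) : ℝ) ^ (-(1 / 3 : ℝ)) / σ ^ 2 / Real.sqrt θ)) z)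
                    p).1}
          ≤ ENNReal.ofReal (C * Real.exp (-c * M)) := by
  intro hTail a θ ha hθ
  obtain ⟨σ₀, hσ₀, lam, c, C, hc, H⟩ := hTail a θ ha hθ
  refine ⟨σ₀, hσ₀, lam, c, C, hc, fun _ _ σ hσ hσσ₀ Φ => ?_⟩
  filter_upwards [H σ hσ hσσ₀ Φ] with N hN p M hM _ using hN p M hM

end Summit.AtomisticToContinuum.HydrodynamicLimit.Theorems.LogWindowTaggedTail
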